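import Summits.PneNP.PneNP.Theses.KarlinRubin
import Summits.PneNP.PneNP.Theorems.KarlinRubinMonotoneBlindStubBlindAndDnfBound
import Summits.PneNP.PneNP.Theorems.KarlinRubinMonotoneBlindCnf

/-!
# Route KarlinRubin, crux `MonotoneBlind` (stmt-PneNP-18027), line `Sketch` (vertex-cover duality): stub `stub_blindAndDnf`

**Quiet ANDs of polynomially many polynomial-term monotone DNFs are blind to the planted clique** (depth 3 with `∧` on
top, no width restriction). For `0 < δ < 1/2`, `c : ℕ`, `m n ≤ n^c` term families `𝓓 n i` with `≤ n^c` terms each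
(eventually): if the null acceptance `Pr_{G(n,1/2)}[∀ i, some term of 𝓓 n i is on] → 0` then the planted acceptance
(`k = ⌈n^{1/2-δ}⌉`) `→ 0` as well (`stub_blindAndDnf`, the registered stub of line `Sketch`).

Proof. If the planted graph `x ∪ K_A` is accepted but the noise `x` is not, some `𝓓 n i` is DEAD at `x` and REVIVED
by `A`: `A` covers the vertex set of a minimal missing set `F = E \ x` of `𝓓 n i` — an object determined by `x` alone,
of which `A` is independent. Minimal missing sets with `> b = C(2c+1, 2)` slots span `≥ 2c+2` vertices (probability
`≤ (d/n)^{2c+2}`, union over `≤ n^c` of them: `≤ n⁻¹`); those with `≤ b` slots span `≥ 2` vertices (probability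
`≤ d²/n²` each), so they only matter when there are `≥ u ≈ n²/((q+1)d²)` of them — and by the peeling count
(`KarlinRubinMonotoneBlindStubBlindAndDnfPeel.lean`: the `L`-th moment of their number over dead points is
polylogarithmic once wide terms are discarded) that has probability `≤ polylog(n)/u^L ≤ n⁻¹` per DNF. Hence
(`andDnf_planted_le_null_add`) `Pr_planted ≤ Pr_null + 3 n⁻¹ + (q+1)⁻¹` eventually, for every `q`.

All `--supports stmt-PneNP-18027`; no definitions.
-/

set_option linter.dupNamespace false -- `Summit.PneNP.PneNP.…` is the layout-mandated namespace (D-0017)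

namespace Summit.PneNP.PneNP.Theorems.MonotoneBlind.VertexCover

open Literature.Computability.Complexity Literature.Probability.RandomGraphs.PlantedClique Filter Finset
open scoped ENNReal Topology Classical

/-! ### The per-`n` bound with the parameters of the stub -/

/-- The number of edge slots of `Kₙ` is at most `n²`. [folklore] -/
theorem card_edgeSet_top_le_sq (n : ℕ) : Fintype.card (⊤ : SimpleGraph (Fin n)).edgeSet ≤ n ^ 2 :=
  calc Fintype.card (⊤ : SimpleGraph (Fin n)).edgeSet ≤ Fintype.card (Sym2 (Fin n)) :=
        Fintype.card_le_of_injective (fun e => (e : Sym2 (Fin n))) Subtype.coe_injective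
    _ ≤ Fintype.card (Fin n × Fin n) :=
        Fintype.card_le_of_surjective (Function.uncurry Sym2.mk) Sym2.mk_surjective
    _ = n ^ 2 := by rw [Fintype.card_prod, Fintype.card_fin, sq]

/-- **Per-`n` bound with the stub's parameters.** For `m ≤ n^c` term families with `≤ n^c` terms each, clique size
`k` with `d = min k n ≥ 1`, `ℓ = ⌊log₂ n⌋ ≥ q + 1`, `(2ℓ⁴d)² ≤ n` and the polylogarithmic constant `A₀ ≤ n`:
`Pr_planted[∀ i, 𝓓 i fires] ≤ Pr_null[∀ i, 𝓓 i fires] + 3 n⁻¹ + (q+1)⁻¹` (`andDnf_planted_le` with `b = C(2c+1,2)`,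
`v₀ = 2c+2`, `L = c+2`, `w = (2bL+2c+4)(ℓ+1)`, `u = ⌊n²/((q+1)d²)⌋ ≥ n`). [folklore] -/
theorem andDnf_planted_le_null_add {n : ℕ} (k c q : ℕ) {m : ℕ}
    (𝓓 : Fin m → Finset (Finset (⊤ : SimpleGraph (Fin n)).edgeSet))
    (hm : m ≤ n ^ c) (hs : ∀ i, #(𝓓 i) ≤ n ^ c)
    (H1 : (2 * Nat.log 2 n ^ 4 * min k n) ^ 2 ≤ n) (hq : q + 1 ≤ Nat.log 2 n) (hk : 1 ≤ min k n)
    (hA : (2 ^ ((2 * c + 1).choose 2 * (c + 2)) * ((2 * c + 1).choose 2 * (c + 2) +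
        (2 * ((2 * c + 1).choose 2 * (c + 2)) + 2 * c + 4) * (Nat.log 2 n + 1)) + 1) ^
          ((2 * c + 1).choose 2 * (c + 2)) * 2 ^ ((2 * c + 1).choose 2 * (c + 2) * (c + 2)) ≤ n) :
    (plantedCliqueDist n k).toOuterMeasure {x | ∀ i, ∃ E ∈ 𝓓 i, ∀ e ∈ E, x e = true} ≤
      (erdosRenyiHalf n).toOuterMeasure {x | ∀ i, ∃ E ∈ 𝓓 i, ∀ e ∈ E, x e = true} +
        (3 * ((n : ℕ) : ℝ≥0∞)⁻¹ + (((q + 1 : ℕ) : ℝ≥0∞))⁻¹) := by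
  set ℓ := Nat.log 2 n with hℓ
  set d := min k n with hd
  set b := (2 * c + 1).choose 2 with hb
  set L := c + 2 with hL
  set B := b * L with hB
  set Cw := 2 * B + 2 * c + 4 with hCw
  set w := Cw * (ℓ + 1) with hw
  set u := n ^ 2 / ((q + 1) * d ^ 2) with hu
  set N := Fintype.card (⊤ : SimpleGraph (Fin n)).edgeSet with hN
  set A₀ := (2 ^ B * (B + w) + 1) ^ B * 2 ^ (B * L) with hA₀
  -- basic numeric facts
  have hℓ1 : 1 ≤ ℓ := le_trans (Nat.le_add_left 1 q) hq
  have hℓpos : 0 < ℓ := hℓ1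
  have hn1 : 1 ≤ n := by
    by_contra h
    have h0 : n = 0 := by omega
    rw [hℓ, h0] at hℓ1
    simp at hℓ1
  have hnpos : 0 < n := hn1
  have hd2 : d ^ 2 ≤ n := by
    calc d ^ 2 ≤ (2 * ℓ ^ 4) ^ 2 * d ^ 2 :=
          Nat.le_mul_of_pos_left _ (pow_pos (Nat.mul_pos two_pos (pow_pos hℓpos 4)) 2)
      _ = (2 * ℓ ^ 4 * d) ^ 2 := by ring
      _ ≤ n := H1
  have hqd : (q + 1) * d ^ 2 ≤ n := by
    calc (q + 1) * d ^ 2 ≤ ℓ * d ^ 2 := Nat.mul_le_mul_right _ hq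
      _ ≤ (2 * ℓ ^ 4) ^ 2 * d ^ 2 := by
          refine Nat.mul_le_mul_right _ ?_
          calc ℓ ≤ ℓ ^ 4 := Nat.le_self_pow (by norm_num) ℓ
            _ ≤ (2 * ℓ ^ 4) ^ 2 := by nlinarith [pow_pos hℓpos 4]
      _ = (2 * ℓ ^ 4 * d) ^ 2 := by ring
      _ ≤ n := H1
  have hqd0 : 0 < (q + 1) * d ^ 2 := Nat.mul_pos (Nat.succ_pos q) (pow_pos hk 2)
  have hun : n ≤ u := (Nat.le_div_iff_mul_le hqd0).2 (by nlinarith [hqd])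
  have hud : u * ((q + 1) * d ^ 2) ≤ n ^ 2 := Nat.div_mul_le_self _ _
  have hNn : N ≤ n ^ 2 := card_edgeSet_top_le_sq n
  have hAn : A₀ ≤ n := hA
  -- the four small terms
  have T1 : ((u * d ^ 2 : ℕ) : ℝ≥0∞) / ((n ^ 2 : ℕ) : ℝ≥0∞) ≤ (((q + 1 : ℕ) : ℝ≥0∞))⁻¹ :=
    natCast_div_le_inv_of_mul_le (by nlinarith [hud]) (by omega)
  have T2 : ((n ^ c * d ^ (2 * c + 2) : ℕ) : ℝ≥0∞) / ((n ^ (2 * c + 2) : ℕ) : ℝ≥0∞) ≤ ((n : ℕ) : ℝ≥0∞)⁻¹ := by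
    refine natCast_div_le_inv_of_mul_le ?_ hnpos.ne'
    have hdpow : d ^ (2 * c + 2) ≤ n ^ (c + 1) :=
      calc d ^ (2 * c + 2) = (d ^ 2) ^ (c + 1) := by rw [← pow_mul, mul_add, mul_one]
        _ ≤ n ^ (c + 1) := Nat.pow_le_pow_left hd2 _
    calc n ^ c * d ^ (2 * c + 2) * n ≤ n ^ c * n ^ (c + 1) * n :=
          Nat.mul_le_mul_right _ (Nat.mul_le_mul_left _ hdpow)
      _ = n ^ (2 * c + 2) := by ring
  have T3 : (m : ℝ≥0∞) * (((A₀ : ℕ) : ℝ≥0∞) / ((u ^ L : ℕ) : ℝ≥0∞)) ≤ ((n : ℕ) : ℝ≥0∞)⁻¹ := by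
    rw [← mul_div_assoc, ← Nat.cast_mul]
    refine natCast_div_le_inv_of_mul_le ?_ hnpos.ne'
    calc m * A₀ * n ≤ n ^ c * n * n := Nat.mul_le_mul_right _ (Nat.mul_le_mul hm hAn)
      _ = n ^ (c + 2) := by ring
      _ ≤ u ^ (c + 2) := Nat.pow_le_pow_left hun _
  have T4 : (m : ℝ≥0∞) * (((n ^ c : ℕ) : ℝ≥0∞) * ((N ^ B : ℕ) : ℝ≥0∞) * 2⁻¹ ^ w) ≤ ((n : ℕ) : ℝ≥0∞)⁻¹ := by
    have h2w : (2⁻¹ : ℝ≥0∞) ^ w ≤ (((n ^ Cw : ℕ) : ℝ≥0∞))⁻¹ := by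
      refine half_pow_le_inv_natCast ?_
      calc n ^ Cw ≤ (2 ^ (ℓ + 1)) ^ Cw := Nat.pow_le_pow_left (Nat.lt_pow_succ_log_self one_lt_two n).le _
        _ = 2 ^ w := by rw [← pow_mul, hw, mul_comm]
    calc (m : ℝ≥0∞) * (((n ^ c : ℕ) : ℝ≥0∞) * ((N ^ B : ℕ) : ℝ≥0∞) * 2⁻¹ ^ w)
        ≤ (m : ℝ≥0∞) * (((n ^ c : ℕ) : ℝ≥0∞) * ((N ^ B : ℕ) : ℝ≥0∞) * (((n ^ Cw : ℕ) : ℝ≥0∞))⁻¹) := by gcongr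
      _ = ((m * (n ^ c * N ^ B) : ℕ) : ℝ≥0∞) / ((n ^ Cw : ℕ) : ℝ≥0∞) := by
          rw [div_eq_mul_inv]; push_cast; ring
      _ ≤ ((n : ℕ) : ℝ≥0∞)⁻¹ := by
          refine natCast_div_le_inv_of_mul_le ?_ hnpos.ne'
          calc m * (n ^ c * N ^ B) * n ≤ n ^ c * (n ^ c * (n ^ 2) ^ B) * n := by
                gcongr
              _ = n ^ (2 * B + 2 * c + 1) := by ring
              _ ≤ n ^ Cw := Nat.pow_le_pow_right hnpos (by omega)
  -- the per-`n` master bound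
  have hmain := andDnf_planted_le hnpos k u w b (2 * c + 2) L (by omega)
    (by rw [show 2 * c + 2 - 1 = 2 * c + 1 by omega]) (by omega) 𝓓 (n ^ c) hs
  refine hmain.trans ?_
  calc _ = (erdosRenyiHalf n).toOuterMeasure {x | ∀ i, ∃ E ∈ 𝓓 i, ∀ e ∈ E, x e = true} +
        ((m : ℝ≥0∞) * (((A₀ : ℕ) : ℝ≥0∞) / ((u ^ L : ℕ) : ℝ≥0∞)) +
          (m : ℝ≥0∞) * (((n ^ c : ℕ) : ℝ≥0∞) * ((N ^ B : ℕ) : ℝ≥0∞) * 2⁻¹ ^ w) +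
          ((n ^ c * d ^ (2 * c + 2) : ℕ) : ℝ≥0∞) / ((n ^ (2 * c + 2) : ℕ) : ℝ≥0∞) +
          ((u * d ^ 2 : ℕ) : ℝ≥0∞) / ((n ^ 2 : ℕ) : ℝ≥0∞)) := by ring
    _ ≤ (erdosRenyiHalf n).toOuterMeasure {x | ∀ i, ∃ E ∈ 𝓓 i, ∀ e ∈ E, x e = true} +
        (((n : ℕ) : ℝ≥0∞)⁻¹ + ((n : ℕ) : ℝ≥0∞)⁻¹ + ((n : ℕ) : ℝ≥0∞)⁻¹ + (((q + 1 : ℕ) : ℝ≥0∞))⁻¹) :=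
        add_le_add le_rfl (add_le_add (add_le_add (add_le_add T3 T4) T2) T1)
    _ = _ := by ring

/-! ### The stub -/

/-- **stub_blindAndDnf: quiet ANDs of polynomially many polynomial-term monotone DNFs are blind to the planted clique.**
For `0 < δ < 1/2`, `c : ℕ`, `m n ≤ n^c` term families `𝓓 n i` (`i : Fin (m n)`) with `#(𝓓 n i) ≤ n^c` eventually:
if `Pr_{G(n,1/2)}[∀ i, ∃ E ∈ 𝓓 n i, E ⊆ x] → 0` then `Pr_{G(n,1/2,⌈n^{1/2-δ}⌉)}[∀ i, ∃ E ∈ 𝓓 n i, E ⊆ x] → 0`.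
Proof: `andDnf_planted_le_null_add` gives `≤ null + 3 n⁻¹ + (q+1)⁻¹` eventually for every `q` (its numeric
hypotheses hold eventually: `eventually_H1`, `n ≥ 2^{q+1}`, and the polylogarithmic constant is `≤ n` by
`exists_nat_ge_polylog_le_rpow`), so the planted acceptance is eventually `≤ ε` for every `ε > 0`. [folklore] -/
theorem stub_blindAndDnf :
    ∀ δ : ℝ, 0 < δ → δ < 1 / 2 → ∀ c : ℕ, ∀ m : ℕ → ℕ,
      ∀ 𝓓 : (n : ℕ) → Fin (m n) → Finset (Finset ((⊤ : SimpleGraph (Fin n)).edgeSet)),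
      (∀ᶠ n : ℕ in atTop, m n ≤ n ^ c) →
      (∀ᶠ n : ℕ in atTop, ∀ i, #(𝓓 n i) ≤ n ^ c) →
      Tendsto (fun n : ℕ => (erdosRenyiHalf n).toOuterMeasure
        {x | ∀ i, ∃ E ∈ 𝓓 n i, ∀ e ∈ E, x e = true}) atTop (𝓝 0) →
      Tendsto (fun n : ℕ => (plantedCliqueDist n ⌈(n : ℝ) ^ (1 / 2 - δ)⌉₊).toOuterMeasure
        {x | ∀ i, ∃ E ∈ 𝓓 n i, ∀ e ∈ E, x e = true}) atTop (𝓝 0) := by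
  intro δ hδ hδ' c m 𝓓 hm hD hquiet
  rw [ENNReal.tendsto_nhds_zero]
  intro ε hε
  have hε3 : ε / 3 ≠ 0 := (ENNReal.div_pos_iff.2 ⟨hε.ne', by norm_num⟩).ne'
  have hε3pos : 0 < ε / 3 := pos_iff_ne_zero.2 hε3
  obtain ⟨q, hq⟩ := ENNReal.exists_inv_nat_lt hε3
  -- eventual facts
  have hnull : ∀ᶠ n : ℕ in atTop,
      (erdosRenyiHalf n).toOuterMeasure {x | ∀ i, ∃ E ∈ 𝓓 n i, ∀ e ∈ E, x e = true} ≤ ε / 3 :=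
    ENNReal.tendsto_nhds_zero.1 hquiet _ hε3pos
  have hinv : ∀ᶠ n : ℕ in atTop, 3 * ((n : ℕ) : ℝ≥0∞)⁻¹ ≤ ε / 3 := by
    have h : Tendsto (fun n : ℕ => (3 : ℝ≥0∞) * ((n : ℕ) : ℝ≥0∞)⁻¹) atTop (𝓝 0) := by
      have h0 := ENNReal.Tendsto.const_mul ENNReal.tendsto_inv_nat_nhds_zero
        (Or.inr ENNReal.ofNat_ne_top : (0 : ℝ≥0∞) ≠ 0 ∨ (3 : ℝ≥0∞) ≠ ⊤)
      simpa using h0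
    exact ENNReal.tendsto_nhds_zero.1 h _ hε3pos
  have hlog : ∀ᶠ n : ℕ in atTop, q + 1 ≤ Nat.log 2 n := by
    filter_upwards [eventually_ge_atTop (2 ^ (q + 1))] with n hn
    exact Nat.le_log_of_pow_le one_lt_two hn
  have hk : ∀ᶠ n : ℕ in atTop, 1 ≤ min ⌈(n : ℝ) ^ (1 / 2 - δ)⌉₊ n := by
    filter_upwards [eventually_ge_atTop 1] with n hn
    refine le_min (Nat.one_le_ceil_iff.2 ?_) hn
    exact Real.rpow_pos_of_pos (by exact_mod_cast hn) _
  -- the polylogarithmic constant is eventually `≤ n`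
  set B := (2 * c + 1).choose 2 * (c + 2) with hB
  set Cw := 2 * B + 2 * c + 4 with hCw
  obtain ⟨N₀, hN₀⟩ := exists_nat_ge_polylog_le_rpow (2 ^ (B * (c + 2))) B (2 ^ B * Cw) (2 ^ B * (B + Cw) + 1)
    one_pos
  have hA : ∀ᶠ n : ℕ in atTop,
      (2 ^ B * (B + Cw * (Nat.log 2 n + 1)) + 1) ^ B * 2 ^ (B * (c + 2)) ≤ n := by
    filter_upwards [eventually_ge_atTop N₀] with n hn
    have h := hN₀ n hn
    rw [Real.rpow_one] at h
    have hid : (2 ^ B * (B + Cw * (Nat.log 2 n + 1)) + 1) ^ B * 2 ^ (B * (c + 2)) =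
        2 ^ (B * (c + 2)) * (2 ^ B * Cw * Nat.log 2 n + (2 ^ B * (B + Cw) + 1)) ^ B := by ring
    rw [hid]
    have hC : (0 : ℝ) ≤ ((2 ^ (B * (c + 2)) : ℕ) : ℝ) := Nat.cast_nonneg _
    have h' : (((2 ^ (B * (c + 2)) * (2 ^ B * Cw * Nat.log 2 n + (2 ^ B * (B + Cw) + 1)) ^ B : ℕ)) : ℝ) ≤ n := by
      have h2 : (((2 ^ (B * (c + 2)) * (2 ^ B * Cw * Nat.log 2 n + (2 ^ B * (B + Cw) + 1)) ^ B : ℕ)) : ℝ) =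
          ((2 ^ (B * (c + 2)) : ℕ) : ℝ) *
            ((((2 ^ B * Cw : ℕ)) : ℝ) * ((Nat.log 2 n : ℕ) : ℝ) + (((2 ^ B * (B + Cw) + 1 : ℕ)) : ℝ)) ^ B := by
        push_cast; ring
      rw [h2]
      linarith
    exact_mod_cast h'
  filter_upwards [hm, hD, hnull, hinv, hlog, hk, hA, eventually_H1 hδ hδ'] with n hmn hDn hnulln hinvn hlogn hkn
    hAn H1
  calc (plantedCliqueDist n ⌈(n : ℝ) ^ (1 / 2 - δ)⌉₊).toOuterMeasure {x | ∀ i, ∃ E ∈ 𝓓 n i, ∀ e ∈ E, x e = true}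
      ≤ (erdosRenyiHalf n).toOuterMeasure {x | ∀ i, ∃ E ∈ 𝓓 n i, ∀ e ∈ E, x e = true} +
          (3 * ((n : ℕ) : ℝ≥0∞)⁻¹ + (((q + 1 : ℕ) : ℝ≥0∞))⁻¹) :=
        andDnf_planted_le_null_add _ c q (𝓓 n) hmn hDn H1 hlogn hkn hAn
    _ ≤ ε / 3 + (ε / 3 + ε / 3) := by
        refine add_le_add hnulln (add_le_add hinvn ?_)
        exact (ENNReal.inv_le_inv.2 (by exact_mod_cast Nat.le_succ q)).trans hq.le
    _ = ε := by rw [← add_assoc, ENNReal.add_thirds]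

end Summit.PneNP.PneNP.Theorems.MonotoneBlind.VertexCover
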